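import Summits.Langlands.Langlands.Theorems.HolomorphicShadowSectorComplementStubEvenArtinShadowData
import Summits.Langlands.Langlands.Theorems.HolomorphicShadowSectorComplementStubEvenArtinPlaneTransport
import HarnessLib

/-!
# Route `HolomorphicShadow` — crux `SectorComplement` (stmt-Langlands-14623), line `pieces`:
# stub B⁺ (`stub_evenArtinPlaneOfMaass`) REDUCED TO ITS TWO UNCARRIED PIECES P₂ and P₄

The strategist's card `Cruxes/SectorComplement/Lines/birth_HolomorphicShadow_EvenArtinPlaneOfMaass.lean`
cuts stub B⁺ (the even Artin plane of Fontaine–Mazur–Langlands from the even-Maass slice `H`) into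
P₁ (Artin data of an even `σ`), P₂ (the Maass-eigenform dictionary with L-algebraicity), P₃
(complex-to-`ℓ`-adic transport) and P₄ (transport along `K ≃+* ℚ`).  P₁ is now PROVED
(`HolomorphicShadow.EvenArtinData.evenArtinShadowData`, this hand) and P₃ is PROVED
(`HolomorphicShadow.complexToLAdicTransport_evenArtinPlane`, p794940).  This file records the
consequence in Lean: the REGISTERED signature of `stub_evenArtinPlaneOfMaass` (verbatim) follows
from P₂ and P₄ alone (texts verbatim from the card), by the card's composition
`EvenArtinPlaneOfMaass_of` with P₁ and P₃ discharged.

* `stub_evenArtinPlaneOfMaass_of_maassDictionary_of_transport (h2 : P₂) (h4 : P₄) :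
  <registered stub B⁺>` — the exact remaining lemma list of stub B⁺ is {P₂, P₄}:
  P₂ = classical `Γ₀(L)`-automorphic Maass lift of eigenvalue `1/4` with Euler-pinned coefficients
  ⇒ cuspidal L-algebraic `P` on `GL₂(𝔸_ℚ)` with matching Satake parameters a.e. (Gelbart 1975 §3,
  Bump 1997 §3.6; no classical-Maass-form-to-automorphic-representation carrier in the tree, XL);
  P₄ = transport of framed Galois representations, levels and cuspidal automorphic representation
  data along the unique `K ≃+* ℚ` when `Module.finrank ℚ K = 1` (formalization debt, L).

HONEST STATUS: CONDITIONAL on P₂ and P₄ (hypotheses, not proved); a bookkeeping composition for one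
stub of an open-problem crux; proves reciprocity for nothing.

References: [Gelbart1975] §3; [Bump1997] §3.6; [BuzzardGeeLMS2014] Def. 3.1.1, Conj. 3.2.2.
-/

noncomputable section

set_option linter.dupNamespace false -- project-wide option; `Summit.Langlands.Langlands` is the mandated namespace

open scoped NumberField Classical Polynomial Matrix
open Filter IsDedekindDomain Polynomial
open Literature.NumberTheory.Automorphic Literature.NumberTheory.GaloisRepresentations
open Summit.Langlands

namespace Summit.Langlands.Langlands.Theorems.HolomorphicShadow.EvenArtinData

open scoped BigOperators Topology Manifold Classical MeasureTheory ProbabilityTheory Matrix InnerProductSpace ComplexConjugate ContinuousMap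
open Filter Set Function TopologicalSpace MeasureTheory

/-- **Stub B⁺ from P₂ and P₄** (P₁ and P₃ proved): fix `σ` irreducible and even; P₁
(`evenArtinShadowData`) gives an admissible Artin datum `(N, χ, ε, a)`; `H` gives a level `L`
(`N ∣ L`) at which the Maass lift is `Γ₀(L)`-automorphic with character `χ`; P₂ turns it into an
L-algebraic cuspidal `P` matching `σ` a.e.; P₃ (`complexToLAdicTransport_evenArtinPlane`) transports
to `ℓ`-adic coefficients over `ℚ`; P₄ to every `K` of degree one.  Conclusion = the registered
signature of `stub_evenArtinPlaneOfMaass` of `Cruxes/SectorComplement/Lines/pieces.lean`, verbatim.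
[cite: Gelbart1975, §3] [cite: BuzzardGeeLMS2014, Def. 3.1.1 and Conj. 3.2.2] -/
theorem stub_evenArtinPlaneOfMaass_of_maassDictionary_of_transport
    (h2 : let K0 : ℝ → ℝ := fun x => ∫ t in Set.Ioi (0 : ℝ), Real.exp (-(x * Real.cosh t)); let maass : (ℕ → ℂ) → ℂ → UpperHalfPlane → ℂ := fun a ε z => ∑' n : ℕ, a (n + 1) * ((Real.sqrt z.im * K0 (2 * Real.pi * ((n : ℝ) + 1) * z.im) : ℝ) : ℂ) * (Complex.exp (2 * Real.pi * Complex.I * ((n : ℂ) + 1) * (z.re : ℂ)) + ε * Complex.exp (-(2 * Real.pi * Complex.I * ((n : ℂ) + 1) * (z.re : ℂ)))); let EulerPin : Literature.NumberTheory.GaloisRepresentations.FramedGaloisRep ℚ ℂ 2 → (N : ℕ) → DirichletCharacter ℂ N → (ℕ → ℂ) → Prop := fun σ N χ a => a 1 = 1 ∧ (∀ m n : ℕ, Nat.Coprime m n → a (m * n) = a m * a n) ∧ (∀ p : ℕ, p.Prime → p ∣ N → ∀ j : ℕ, a (p ^ (j + 1)) = 0) ∧ (∀ p : ℕ, p.Prime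 → ¬ p ∣ N → (∀ j : ℕ, a (p ^ (j + 2)) = a p * a (p ^ (j + 1)) - χ (p : ZMod N) * a (p ^ j)) ∧ ∀ v : IsDedekindDomain.HeightOneSpectrum (NumberField.RingOfIntegers ℚ), (p : NumberField.RingOfIntegers ℚ) ∈ v.asIdeal → Literature.NumberTheory.GaloisRepresentations.FramedGaloisRep.IsUnramifiedAt v σ ∧ Literature.NumberTheory.GaloisRepresentations.FramedGaloisRep.HasFrobCharpolyAt v (Polynomial.X ^ 2 - Polynomial.C (a p) * Polynomial.X + Polynomial.C (χ (p : ZMod N))) σ); ∀ σ : Literature.NumberTheory.GaloisRepresentations.FramedGaloisRep ℚ ℂ 2, σ.toGaloisRep.IsIrreducible → ∀ (N L : ℕ) (χ : DirichletCharacter ℂ N) (ε : ℂ) (a : ℕ → ℂ), 0 < N → N ∣ L → 0 < L → (ε = 1 ∨ ε = -1) → (∃ C A : ℝ, ∀ n : ℕ, ‖a n‖ ≤ C * ((n : ℝ) + 1) ^ A) → EulerPin σ N χ a → (∀ γ ∈ CongruenceSubgroup.Gamma0 L, ∀ z : UpperHalfPlane, maass a ε (γ • z) = χ ((((γ : Matrix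 (Fin 2) (Fin 2) ℤ) 1 1 : ℤ) : ZMod N)) * maass a ε z) → ∃ (hcpt : Literature.NumberTheory.Automorphic.isCompact_glFiniteIntegralLevel 2 ℚ) (P : Literature.NumberTheory.Automorphic.CuspidalAutomorphicRepData 2 ℚ hcpt), P.1.IsLAlgebraic ∧ (∀ᶠ v : IsDedekindDomain.HeightOneSpectrum (NumberField.RingOfIntegers ℚ) in Filter.cofinite, ∃ α : Multiset ℂ, Literature.NumberTheory.Automorphic.AutomorphicRepData.HasSatakeParamAt P.1 v α ∧ Literature.NumberTheory.GaloisRepresentations.FramedGaloisRep.IsUnramifiedAt v σ ∧ Literature.NumberTheory.GaloisRepresentations.FramedGaloisRep.HasFrobCharpolyAt v (Literature.NumberTheory.Automorphic.satakePolynomial α) σ))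
    (h4 : (∀ (hcpt : Literature.NumberTheory.Automorphic.isCompact_glFiniteIntegralLevel 2 ℚ) (ℓ : ℕ) [Fact ℓ.Prime] (ι : PadicAlgCl ℓ ≃+* ℂ) (ρ : Literature.NumberTheory.GaloisRepresentations.FramedGaloisRep ℚ (PadicAlgCl ℓ) 2), ρ.toGaloisRep.IsIrreducible → IsOpen (ρ.toMonoidHom.ker : Set (Field.absoluteGaloisGroup ℚ)) → (∀ (φ : ℚ →+* ℝ) (c : Field.absoluteGaloisGroup ℚ), Literature.NumberTheory.GaloisRepresentations.IsComplexConjugation φ c → Matrix.GeneralLinearGroup.det (ρ c) = 1) → ∃ π : Literature.NumberTheory.Automorphic.CuspidalAutomorphicRepData 2 ℚ hcpt, π.1.IsLAlgebraic ∧ ∀ᶠ v : IsDedekindDomain.HeightOneSpectrum (NumberField.RingOfIntegers ℚ) in cofinite, SatakeFrobCompatibleAt ι π.1 ρ v) →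
    ∀ (K : Type) [Field K] [NumberField K], Module.finrank ℚ K = 1 → ∀ (hcpt : Literature.NumberTheory.Automorphic.isCompact_glFiniteIntegralLevel 2 K) (ℓ : ℕ) [Fact ℓ.Prime] (ι : PadicAlgCl ℓ ≃+* ℂ) (ρ : Literature.NumberTheory.GaloisRepresentations.FramedGaloisRep K (PadicAlgCl ℓ) 2), ρ.toGaloisRep.IsIrreducible → IsOpen (ρ.toMonoidHom.ker : Set (Field.absoluteGaloisGroup K)) → (∀ (φ : K →+* ℝ) (c : Field.absoluteGaloisGroup K), Literature.NumberTheory.GaloisRepresentations.IsComplexConjugation φ c → Matrix.GeneralLinearGroup.det (ρ c) = 1) → ∃ π : Literature.NumberTheory.Automorphic.CuspidalAutomorphicRepData 2 K hcpt, π.1.IsLAlgebraic ∧ ∀ᶠ v : IsDedekindDomain.HeightOneSpectrum (NumberField.RingOfIntegers K) in cofinite, SatakeFrobCompatibleAt ι π.1 ρ v) :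
    let K0 : ℝ → ℝ := fun x => ∫ t in Set.Ioi (0 : ℝ), Real.exp (-(x * Real.cosh t)); let maass : (ℕ → ℂ) → ℂ → UpperHalfPlane → ℂ := fun a ε z => ∑' n : ℕ, a (n + 1) * ((Real.sqrt z.im * K0 (2 * Real.pi * ((n : ℝ) + 1) * z.im) : ℝ) : ℂ) * (Complex.exp (2 * Real.pi * Complex.I * ((n : ℂ) + 1) * (z.re : ℂ)) + ε * Complex.exp (-(2 * Real.pi * Complex.I * ((n : ℂ) + 1) * (z.re : ℂ)))); let EulerPin : Literature.NumberTheory.GaloisRepresentations.FramedGaloisRep ℚ ℂ 2 → (N : ℕ) → DirichletCharacter ℂ N → (ℕ → ℂ) → Prop := fun σ N χ a => a 1 = 1 ∧ (∀ m n : ℕ, Nat.Coprime m n → a (m * n) = a m * a n) ∧ (∀ p : ℕ, p.Prime → p ∣ N → ∀ j : ℕ, a (p ^ (j + 1)) = 0) ∧ (∀ p : ℕ, p.Prime → ¬ p ∣ N → (∀ j : ℕ, a (p ^ (j + 2)) = a p * a (p ^ (j + 1)) - χ (p : ZMod N) * a (p ^ j)) ∧ ∀ v : IsDedekindDomain.HeightOneSpectrum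 (NumberField.RingOfIntegers ℚ), (p : NumberField.RingOfIntegers ℚ) ∈ v.asIdeal → Literature.NumberTheory.GaloisRepresentations.FramedGaloisRep.IsUnramifiedAt v σ ∧ Literature.NumberTheory.GaloisRepresentations.FramedGaloisRep.HasFrobCharpolyAt v (Polynomial.X ^ 2 - Polynomial.C (a p) * Polynomial.X + Polynomial.C (χ (p : ZMod N))) σ); let ParityPin : Literature.NumberTheory.GaloisRepresentations.FramedGaloisRep ℚ ℂ 2 → ℂ → Prop := fun σ ε => ∀ (φ : ℚ →+* ℝ) (c : Field.absoluteGaloisGroup ℚ), Literature.NumberTheory.GaloisRepresentations.IsComplexConjugation φ c → ((σ c : GL (Fin 2) ℂ) : Matrix (Fin 2) (Fin 2) ℂ) = ε • (1 : Matrix (Fin 2) (Fin 2) ℂ); (∀ σ : Literature.NumberTheory.GaloisRepresentations.FramedGaloisRep ℚ ℂ 2, σ.toGaloisRep.IsIrreducible → ∀ (N : ℕ) (χ : DirichletCharacter ℂ N) (ε : ℂ) (a : ℕ → ℂ), 0 < N → (ε = 1 ∨ ε = -1) → ParityPin σ ε → (∃ C A : ℝ, ∀ n : ℕ, ‖a n‖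 ≤ C * ((n : ℝ) + 1) ^ A) → EulerPin σ N χ a → ∃ L : ℕ, 0 < L ∧ N ∣ L ∧ ∀ γ ∈ CongruenceSubgroup.Gamma0 L, ∀ z : UpperHalfPlane, maass a ε (γ • z) = χ ((((γ : Matrix (Fin 2) (Fin 2) ℤ) 1 1 : ℤ) : ZMod N)) * maass a ε z) → ∀ (K : Type) [Field K] [NumberField K], Module.finrank ℚ K = 1 → ∀ (hcpt : Literature.NumberTheory.Automorphic.isCompact_glFiniteIntegralLevel 2 K) (ℓ : ℕ) [Fact ℓ.Prime] (ι : PadicAlgCl ℓ ≃+* ℂ) (ρ : Literature.NumberTheory.GaloisRepresentations.FramedGaloisRep K (PadicAlgCl ℓ) 2), ρ.toGaloisRep.IsIrreducible → IsOpen (ρ.toMonoidHom.ker : Set (Field.absoluteGaloisGroup K)) → (∀ (φ : K →+* ℝ) (c : Field.absoluteGaloisGroup K), Literature.NumberTheory.GaloisRepresentations.IsComplexConjugation φ c → Matrix.GeneralLinearGroup.det (ρ c) = 1) → ∃ π : Literature.NumberTheory.Automorphic.CuspidalAutomorphicRepData 2 K hcpt, π.1.IsLAlgebraic ∧ ∀ᶠ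 v : IsDedekindDomain.HeightOneSpectrum (NumberField.RingOfIntegers K) in cofinite, SatakeFrobCompatibleAt ι π.1 ρ v := by
  intro K0 maass EulerPin ParityPin hH
  refine h4 (HolomorphicShadow.complexToLAdicTransport_evenArtinPlane ?_)
  intro σ hirr heven
  obtain ⟨N, χ, ε, a, hN, hε, hpar, hgr, hpin⟩ := evenArtinShadowData σ hirr heven
  obtain ⟨L, hL, hNL, haut⟩ := hH σ hirr N χ ε a hN hε hpar hgr hpin
  exact h2 σ hirr N L χ ε a hN hNL hL hε hgr hpin haut

end Summit.Langlands.Langlands.Theorems.HolomorphicShadow.EvenArtinData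

end
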